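import Summits.MatrixMultiplication.OmegaCensus.SmallFormats.MatMul22nRankFiniteField
import HarnessLib

/-!
# ω-census family (a): the finite-field bound for the orientations `⟨2,n,2⟩` and `⟨n,2,2⟩`

Cell `pub-omega` (unit `pub-omega-tensor-g6`), topic `Summits/MatrixMultiplication/OmegaCensus`
(sub-folder `SmallFormats`). Framing (verbatim): lottery ticket; floor = certified bounds/negative ranges.
HONEST FRAMING: bookkeeping corollaries of `MatMul22nRankFiniteField` (`3(q²+3)n ≤ (q²+2)·R_𝔽_q(⟨2,2,n⟩)`,
the Alekseev–Nazarov value) under the cyclic/transpose symmetries of the rank (`Blaser2013_lemma55`), so that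
the census table carries the same kernel floor for all three orientations; plus the numerals most often
quoted (`q = 4, 5`; `q = 2, 3` are the tree's `MatMul22nRankGF2LowerBound` / `MatMul22nRankGF3ThirtySixElevenths`).
Nothing here is progress on `ω`.
-/

namespace Summit.MatrixMultiplication.OmegaCensus.SmallFormats

open Literature.Computability.AlgebraicComplexity

/-- `3(q²+3)n ≤ (q²+2)·R_𝔽_q(⟨2,n,2⟩)`. -/
theorem three_mul_sq_add_three_mul_le_tensorRank_matMulTensor_2n2 (k : Type*) [Field k] [Fintype k] (n : ℕ) :
    3 * (Fintype.card k ^ 2 + 3) * n ≤ (Fintype.card k ^ 2 + 2) * tensorRank (matMulTensor k 2 n 2) := by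
  rw [← (Blaser2013_lemma55 k 2 2 n).2.2.2.2]
  exact three_mul_sq_add_three_mul_le_tensorRank_matMulTensor_22n k n

/-- `3(q²+3)n ≤ (q²+2)·R_𝔽_q(⟨n,2,2⟩)`. -/
theorem three_mul_sq_add_three_mul_le_tensorRank_matMulTensor_n22 (k : Type*) [Field k] [Fintype k] (n : ℕ) :
    3 * (Fintype.card k ^ 2 + 3) * n ≤ (Fintype.card k ^ 2 + 2) * tensorRank (matMulTensor k n 2 2) := by
  rw [← (Blaser2013_lemma55 k 2 2 n).1]
  exact three_mul_sq_add_three_mul_le_tensorRank_matMulTensor_22n k n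

/-- `q = 4`: `19n ≤ 6·R_𝔽₄(⟨2,2,n⟩)` (any field with four elements). -/
theorem nineteen_mul_le_six_mul_tensorRank_matMulTensor_22n_card_four (k : Type*) [Field k] [Fintype k]
    (hk : Fintype.card k = 4) (n : ℕ) : 19 * n ≤ 6 * tensorRank (matMulTensor k 2 2 n) := by
  have h := three_mul_sq_add_three_mul_le_tensorRank_matMulTensor_22n k n
  rw [hk] at h
  omega

/-- `q = 5`: `28n ≤ 9·R_𝔽₅(⟨2,2,n⟩)`; e.g. `R_𝔽₅(⟨2,2,n⟩) ≥ 3n + 3` for `n ≥ 19`, beyond the any-field `3n + 2`. -/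
theorem twentyeight_mul_le_nine_mul_tensorRank_matMulTensor_22n_gf5 (n : ℕ) :
    28 * n ≤ 9 * tensorRank (matMulTensor (ZMod 5) 2 2 n) := by
  haveI : Fact (Nat.Prime 5) := ⟨by norm_num⟩
  have h := three_mul_sq_add_three_mul_le_tensorRank_matMulTensor_22n (ZMod 5) n
  rw [ZMod.card] at h
  omega

end Summit.MatrixMultiplication.OmegaCensus.SmallFormats
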